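import Mathlib.Topology.Compactification.OnePoint.Sphere
import Mathlib.Topology.Homotopy.Contractible
import Mathlib.Analysis.Normed.Group.Bounded
import Mathlib.Analysis.Normed.Module.Basic
import Mathlib.Analysis.InnerProductSpace.PiL2
import Mathlib.Topology.MetricSpace.ProperSpace
import Literature.AlgebraicTopology.Homotopy.CollaredDeformationRetract
import HarnessLib

/-!
# A space which is contractible after removing a point with a Euclidean neighbourhood is a homotopy sphere

Topic `Literature/AlgebraicTopology/Homotopy`. Elementary homotopy theory absent from Mathlib.

**Theorem** (`Literature.AlgebraicTopology.Homotopy.Pinch.homotopyEquiv`, `Literature.AlgebraicTopology.Homotopy.nonempty_homotopyEquiv_onePoint_of_contractibleSpace_compl`,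
`Literature.AlgebraicTopology.Homotopy.nonempty_homotopyEquiv_sphere_of_contractibleSpace_compl`). Let `M` be a Hausdorff space,
`E` a proper real normed space and `φ : E → M` an open embedding, and suppose that
`M ∖ {φ 0}` is contractible. Then `M` is homotopy equivalent to the one-point compactification
`OnePoint E` of `E`; in particular (`E = ℝⁿ`, Mathlib's `onePointEquivSphereOfFinrankEq`) `M` is
homotopy equivalent to the sphere `Sⁿ`.

This is the homotopy-theoretic content of the remark that a closed manifold `M` with a point `p`
such that `M ∖ {p}` is contractible is a homotopy sphere: `M` is the homotopy pushout of
`M ∖ {p} ← (chart ∖ {p}) ≃ Sⁿ⁻¹ → chart ≃ pt`, i.e. the suspension of `Sⁿ⁻¹`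
(cf. Hatcher, *Algebraic Topology* (2002), Example 0.10 (suspension `S Sⁿ⁻¹ = Sⁿ`) and
Prop. 0.17/0.18 (collapsing a contractible subcomplex); here for the elementary situation of a
point with a Euclidean neighbourhood, where all maps can be written down). It is used in
`Literature/Topology/FourManifolds/` to show that a Gluck twist is a homotopy 4-sphere
(Gluck, Trans. AMS 104 (1962), §17) without Hurewicz/Whitehead theorems.

**Proof** (all maps explicit). Write `B_r = φ(ball 0 r)`, `W = M ∖ {φ 0}`, and let
`C : [0,1] × W → W` be a contraction (`C₀ = id`, `C₁ = c₀`).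
* The *pinch map* `f : M → OnePoint E`: `f (φ w) = (1 - ‖w‖)⁻¹ • w` for `‖w‖ < 1`, `f = ∞`
  off `B₁`.
* The *cone map* `g : OnePoint E → M`: `g w = φ w` for `‖w‖ ≤ 1`,
  `g w = C (1 - ‖w‖⁻¹, φ (w/‖w‖))` for `‖w‖ ≥ 1`, `g ∞ = c₀` (continuity at `∞` by the tube
  lemma over the compact sphere `φ (∂B₁)`).
* `g ∘ f ≃ id_M`: `G_s (φ w) = φ (((1-s) + s (1-‖w‖)⁻¹) w)` for `‖w‖ ≤ 1/2`,
  `G_s (φ w) = C (s (2 - ‖w‖⁻¹), φ (((1-s) + s ‖w‖⁻¹) w))` for `1/2 ≤ ‖w‖ ≤ 1`,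
  `G_s x = C (s, x)` off `B₁`.
* `f ∘ g ≃ id`: first `f ∘ g`, which maps the complement of `B₁ ⊆ OnePoint E` into
  `OnePoint E ∖ {0}`, is deformed there to `∞` by the dilations `v ↦ (1-s)⁻¹ v` (fixing `∞`),
  giving the map `k`, `k w = (1-‖w‖)⁻¹ w` on the open unit ball and `k = ∞` elsewhere; then
  `K_t w = (1 - t‖w‖)⁻¹ w` (`= ∞` when `t ‖w‖ ≥ 1`) deforms `id` (`t = 0`) to `k` (`t = 1`).
Continuity of the `OnePoint E`-valued maps is checked with `Literature.AlgebraicTopology.Homotopy.OnePointMaps.continuousOn_coeOrInfty`: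
a map equal to `↑(g a)` on an open set `U` and to `∞` off `U` is continuous as soon as `g` is
continuous on `U` and `‖g‖ → ∞` at the points outside `U`.

## References

* A. Hatcher, *Algebraic Topology*, CUP 2002, Ch. 0 (Example 0.10, Prop. 0.17, 0.18)
  [HatcherAT2002].

## Design notes

* Homotopies are handled as plain continuous maps `[0,1] × _ → _` and packaged at the end
  (`Literature.Pinch.homotopyEquiv : M ≃ₕ OnePoint E`); the contraction of `M ∖ {φ 0}` is
  `Literature.AlgebraicTopology.Homotopy.ctrMap` of `CollaredDeformationRetract.lean`.
* Everything is in namespace `Literature` (`Literature.OnePointMaps`, `Literature.Pinch`); no named facts are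
  introduced and no declaration uses `sorry`.
-/

noncomputable section

open Set Filter Function Topology OnePoint Metric ContinuousMap
open scoped unitInterval Topology

namespace Literature.AlgebraicTopology.Homotopy

attribute [local instance] Classical.propDecidable

/-! ### §1 Continuous maps into a one-point compactification -/

namespace OnePointMaps

section Norm

variable {E : Type*} [NormedAddCommGroup E]

/-- If `‖g a‖ → ∞` along a filter then `↑(g a) → ∞` in `OnePoint E` (`E` proper). [folklore] -/
theorem tendsto_coe_infty_of_norm [ProperSpace E] {α : Type*} {l : Filter α} {g : α → E}
    (h : Tendsto (fun a => ‖g a‖) l atTop) :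
    Tendsto (fun a => (g a : OnePoint E)) l (𝓝 ∞) := by
  have h1 : Tendsto g l (cocompact E) := by
    rw [← Metric.cobounded_eq_cocompact]
    exact tendsto_norm_atTop_iff_cobounded.1 h
  have h2 : Tendsto g l (coclosedCompact E) := by
    rwa [Filter.coclosedCompact_eq_cocompact]
  exact OnePoint.tendsto_coe_infty.comp h2

/-- The underlying point of `z : OnePoint E` (junk value `0` at `∞`). [folklore] -/
def elim0 (z : OnePoint E) : E := z.elim 0 id

/-- `elim0 ↑x = x`. [folklore] -/
@[simp] theorem elim0_coe (x : E) : elim0 (x : OnePoint E) = x := rfl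

/-- `elim0 ∞ = 0` (junk value). [folklore] -/
@[simp] theorem elim0_infty : elim0 (∞ : OnePoint E) = 0 := rfl

/-- `↑(elim0 z) = z` for `z ≠ ∞`. [folklore] -/
theorem coe_elim0 {z : OnePoint E} (hz : z ≠ ∞) : ((elim0 z : E) : OnePoint E) = z := by
  induction z using OnePoint.rec with
  | infty => exact absurd rfl hz
  | coe x => rfl

/-- `elim0` is continuous at every finite point. [folklore] -/
theorem continuousAt_elim0 (x : E) : ContinuousAt (elim0 : OnePoint E → E) x := by
  rw [OnePoint.continuousAt_coe]
  exact continuousAt_id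

/-- `elim0` is continuous off `∞`. [folklore] -/
theorem continuousOn_elim0 : ContinuousOn (elim0 : OnePoint E → E) {∞}ᶜ := by
  intro z hz
  induction z using OnePoint.rec with
  | infty => exact absurd rfl hz
  | coe x => exact (continuousAt_elim0 x).continuousWithinAt

/-- The set of finite points of `OnePoint E` is open. [folklore] -/
theorem isOpen_ne_infty : IsOpen ({z : OnePoint E | z ≠ ∞}) := by
  have : ({z : OnePoint E | z ≠ ∞}) = ({∞}ᶜ : Set (OnePoint E)) := rfl
  rw [this, isOpen_compl_iff]
  exact OnePoint.isClosed_infty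

/-- Near `∞`, the norm of the underlying point is large (`E` proper). [folklore] -/
theorem tendsto_norm_elim0_nhdsWithin_infty [ProperSpace E] :
    Tendsto (fun z : OnePoint E => ‖elim0 z‖) (𝓝[≠] ∞) atTop := by
  rw [OnePoint.nhdsNE_infty_eq, Filter.coclosedCompact_eq_cocompact, tendsto_map'_iff]
  exact tendsto_norm_cocompact_atTop

end Norm

section Glue

variable {E : Type*} {α : Type*}

/-- **Gluing a finite part and `∞`.** The map equal to `↑(g a)` on `U` and to `∞` off `U`.
[folklore] -/
def coeOrInfty (U : Set α) (g : α → E) (a : α) : OnePoint E :=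
  if a ∈ U then ((g a : E) : OnePoint E) else ∞

/-- The glued map on `U`. [folklore] -/
theorem coeOrInfty_of_mem {U : Set α} {g : α → E} {a : α} (ha : a ∈ U) :
    coeOrInfty U g a = (g a : OnePoint E) := by
  simp [coeOrInfty, ha]

/-- The glued map off `U`. [folklore] -/
theorem coeOrInfty_of_not_mem {U : Set α} {g : α → E} {a : α} (ha : a ∉ U) :
    coeOrInfty U g a = ∞ := by
  simp [coeOrInfty, ha]

/-- `coeOrInfty U g a = ∞ ↔ a ∉ U`. [folklore] -/
theorem coeOrInfty_eq_infty_iff {U : Set α} {g : α → E} {a : α} :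
    coeOrInfty U g a = ∞ ↔ a ∉ U := by
  by_cases ha : a ∈ U
  · simp [coeOrInfty_of_mem ha, ha]
  · simp [coeOrInfty_of_not_mem ha, ha]

end Glue

section GlueContinuous

variable {E : Type*} [NormedAddCommGroup E] [ProperSpace E] {α : Type*} [TopologicalSpace α]

/-- **Continuity of the glued map** on a set `S`: `U` open, `g` continuous on `S ∩ U`, and
`‖g‖ → ∞` at the points of `S` outside `U` (approached inside `S ∩ U`). [folklore] -/
theorem continuousOn_coeOrInfty {U S : Set α} (hU : IsOpen U) {g : α → E}
    (hg : ContinuousOn g (S ∩ U))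
    (hinf : ∀ a ∈ S, a ∉ U → Tendsto (fun x => ‖g x‖) (𝓝[S ∩ U] a) atTop) :
    ContinuousOn (coeOrInfty U g) S := by
  intro a haS
  by_cases ha : a ∈ U
  · -- near `a`, the map is `↑(g x)`
    have h1 : ContinuousWithinAt (fun x => ((g x : E) : OnePoint E)) S a := by
      have hga : ContinuousWithinAt g (S ∩ U) a := hg a ⟨haS, ha⟩
      have hga' : ContinuousWithinAt g S a :=
        (continuousWithinAt_inter (hU.mem_nhds ha)).1 hga
      exact OnePoint.continuous_coe.continuousAt.comp_continuousWithinAt hga'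
    refine h1.congr_of_eventuallyEq ?_ (coeOrInfty_of_mem ha)
    have : ∀ᶠ x in 𝓝[S] a, x ∈ U := mem_nhdsWithin_of_mem_nhds (hU.mem_nhds ha)
    exact this.mono fun x hx => coeOrInfty_of_mem hx
  · -- `a ∉ U`: the value is `∞`
    show Tendsto (coeOrInfty U g) (𝓝[S] a) (𝓝 (coeOrInfty U g a))
    rw [coeOrInfty_of_not_mem ha]
    have hsplit : 𝓝[S] a = 𝓝[S ∩ U] a ⊔ 𝓝[S ∩ Uᶜ] a := by
      rw [← nhdsWithin_union, ← inter_union_distrib_left, union_compl_self, inter_univ]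
    rw [hsplit]
    refine Tendsto.sup ?_ ?_
    · have h1 : Tendsto (fun x => ((g x : E) : OnePoint E)) (𝓝[S ∩ U] a) (𝓝 ∞) :=
        tendsto_coe_infty_of_norm (hinf a haS ha)
      refine h1.congr' ?_
      have : ∀ᶠ x in 𝓝[S ∩ U] a, x ∈ S ∩ U := self_mem_nhdsWithin
      exact this.mono fun x hx => (coeOrInfty_of_mem hx.2).symm
    · refine tendsto_const_nhds.congr' ?_
      have : ∀ᶠ x in 𝓝[S ∩ Uᶜ] a, x ∈ S ∩ Uᶜ := self_mem_nhdsWithin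
      exact this.mono fun x hx => (coeOrInfty_of_not_mem hx.2).symm

/-- **Continuity of the glued map**: `U` open, `g` continuous on `U`, and `‖g‖ → ∞` at the
points outside `U` (approached inside `U`). [folklore] -/
theorem continuous_coeOrInfty {U : Set α} (hU : IsOpen U) {g : α → E}
    (hg : ContinuousOn g U) (hinf : ∀ a ∉ U, Tendsto (fun x => ‖g x‖) (𝓝[U] a) atTop) :
    Continuous (coeOrInfty U g) := by
  rw [← continuousOn_univ]
  refine continuousOn_coeOrInfty hU (by simpa using hg) fun a _ ha => ?_
  simpa using hinf a ha

end GlueContinuous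

/-- If `a` is not in the closure of `V`, any divergence condition at `a` within `V` is void.
[folklore] -/
theorem tendsto_atTop_of_not_mem_closure {α : Type*} [TopologicalSpace α] {V : Set α} {a : α}
    (ha : a ∉ closure V) (g : α → ℝ) : Tendsto g (𝓝[V] a) atTop := by
  rw [notMem_closure_iff_nhdsWithin_eq_bot] at ha
  rw [ha]
  exact tendsto_bot

end OnePointMaps

/-! ### §2 The pinch map `M → OnePoint E` and the cone map `OnePoint E → M` -/

namespace Pinch

open OnePointMaps

section Chart

variable {E : Type*} [TopologicalSpace E] [Nonempty E] {M : Type*} [TopologicalSpace M] {φ : E → M}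

/-! #### The inverse chart -/

/-- The inverse chart `ψ : M → E` of the open embedding `φ` (`ψ (φ w) = w`; an arbitrary junk
value off `range φ`). [folklore] -/
def chartInv (hφ : IsOpenEmbedding φ) (x : M) : E :=
  if h : x ∈ range φ then hφ.isEmbedding.toHomeomorph.symm ⟨x, h⟩ else Classical.arbitrary E

/-- `ψ (φ w) = w`. [folklore] -/
@[simp] theorem chartInv_apply (hφ : IsOpenEmbedding φ) (w : E) : chartInv hφ (φ w) = w := by
  unfold chartInv
  rw [dif_pos (mem_range_self w)]
  exact hφ.isEmbedding.toHomeomorph_symm_apply w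

/-- `ψ` is continuous on `range φ`. [folklore] -/
theorem continuousOn_chartInv (hφ : IsOpenEmbedding φ) : ContinuousOn (chartInv hφ) (range φ) := by
  rw [continuousOn_iff_continuous_restrict]
  have : (range φ).restrict (chartInv hφ) = fun x => hφ.isEmbedding.toHomeomorph.symm x := by
    funext ⟨x, hx⟩
    simp [Set.restrict_apply, chartInv, hx]
  rw [this]
  exact hφ.isEmbedding.toHomeomorph.symm.continuous

omit [Nonempty E] in
/-- `φ w ∈ φ '' s ↔ w ∈ s`. [folklore] -/
theorem apply_mem_image_iff (hφ : IsOpenEmbedding φ) {s : Set E} {w : E} :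
    φ w ∈ φ '' s ↔ w ∈ s :=
  hφ.injective.mem_set_image

end Chart

variable {E : Type*} [NormedAddCommGroup E] {M : Type*} [TopologicalSpace M] {φ : E → M}

/-- `φ (closedBall 0 r)` is compact (`E` proper). [folklore] -/
theorem isCompact_image_closedBall [ProperSpace E] (hφ : IsOpenEmbedding φ) (r : ℝ) :
    IsCompact (φ '' closedBall (0 : E) r) :=
  (isCompact_closedBall 0 r).image hφ.continuous

/-- `φ (closedBall 0 r)` is closed (`E` proper, `M` Hausdorff). [folklore] -/
theorem isClosed_image_closedBall [ProperSpace E] [T2Space M] (hφ : IsOpenEmbedding φ) (r : ℝ) :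
    IsClosed (φ '' closedBall (0 : E) r) :=
  (isCompact_image_closedBall hφ r).isClosed

/-- `φ (ball 0 r)` is open. [folklore] -/
theorem isOpen_image_ball (hφ : IsOpenEmbedding φ) (r : ℝ) : IsOpen (φ '' ball (0 : E) r) :=
  hφ.isOpenMap _ isOpen_ball

/-- `φ w ≠ φ 0` for `w ≠ 0`, as membership in `M ∖ {φ 0}`. [folklore] -/
theorem apply_mem_compl (hφ : IsOpenEmbedding φ) {w : E} (hw : w ≠ 0) :
    φ w ∈ ({φ 0}ᶜ : Set M) := fun h => hw (hφ.injective h)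

/-- The time parameter `θ w = 1 - ‖w‖⁻¹` (clamped to `[0, 1]`) of the cone map. [folklore] -/
def coneTime (w : E) : I := clampI (1 - ‖w‖⁻¹)

/-- `θ` is continuous off the origin. [folklore] -/
theorem continuousOn_coneTime : ContinuousOn (coneTime : E → I) {w : E | w ≠ 0} :=
  continuous_clampI.comp_continuousOn
    (continuousOn_const.sub (continuousOn_id.norm.inv₀ fun _ hw => norm_ne_zero_iff.2 hw))

/-- `θ w = 0` on the unit sphere. [folklore] -/
theorem coneTime_of_norm_eq_one {w : E} (hw : ‖w‖ = 1) : coneTime w = 0 := by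
  simp [coneTime, hw]

/-- `θ w → 1` as `w → ∞`. [folklore] -/
theorem tendsto_coneTime_cocompact [ProperSpace E] :
    Tendsto (coneTime : E → I) (cocompact E) (𝓝 1) := by
  have h1 : Tendsto (fun w : E => ‖w‖⁻¹) (cocompact E) (𝓝 0) :=
    tendsto_inv_atTop_zero.comp tendsto_norm_cocompact_atTop
  have h2 : Tendsto (fun w : E => 1 - ‖w‖⁻¹) (cocompact E) (𝓝 1) := by
    simpa using (tendsto_const_nhds (x := (1 : ℝ))).sub h1
  have h3 := (continuous_clampI.tendsto 1).comp h2
  rwa [clampI_one] at h3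

/-! #### The pinch map -/

variable [NormedSpace ℝ E]

/-- The finite part of the pinch map, `x ↦ (1 - ‖ψ x‖)⁻¹ • ψ x`. [folklore] -/
def pinchFin (hφ : IsOpenEmbedding φ) (x : M) : E :=
  (1 - ‖chartInv hφ x‖)⁻¹ • chartInv hφ x

/-- **The pinch map** `M → OnePoint E`: `φ w ↦ (1 - ‖w‖)⁻¹ • w` on `φ (ball 0 1)`, `∞`
elsewhere (collapse the complement of the open unit chart ball to the point at infinity).
[folklore] -/
def pinch (hφ : IsOpenEmbedding φ) : M → OnePoint E :=
  coeOrInfty (φ '' ball (0 : E) 1) (pinchFin hφ)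

/-- The pinch map on the open unit chart ball. [folklore] -/
theorem pinch_apply_of_lt (hφ : IsOpenEmbedding φ) {w : E} (hw : ‖w‖ < 1) :
    pinch hφ (φ w) = (((1 - ‖w‖)⁻¹ • w : E) : OnePoint E) := by
  unfold pinch
  rw [coeOrInfty_of_mem ((apply_mem_image_iff hφ).2 (mem_ball_zero_iff.2 hw))]
  simp [pinchFin]

/-- The pinch map off the open unit chart ball. [folklore] -/
theorem pinch_of_not_mem (hφ : IsOpenEmbedding φ) {x : M} (hx : x ∉ φ '' ball (0 : E) 1) :
    pinch hφ x = ∞ :=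
  coeOrInfty_of_not_mem hx

/-- The pinch map at `φ w`, `1 ≤ ‖w‖`. [folklore] -/
theorem pinch_apply_of_le (hφ : IsOpenEmbedding φ) {w : E} (hw : 1 ≤ ‖w‖) :
    pinch hφ (φ w) = ∞ :=
  pinch_of_not_mem hφ (by rw [apply_mem_image_iff hφ, mem_ball_zero_iff]; exact not_lt.2 hw)

/-- Only the centre `φ 0` is pinched to `0`. [folklore] -/
theorem eq_of_pinch_eq_zero (hφ : IsOpenEmbedding φ) {x : M}
    (hx : pinch hφ x = ((0 : E) : OnePoint E)) : x = φ 0 := by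
  by_cases h : x ∈ φ '' ball (0 : E) 1
  · obtain ⟨w, hw, rfl⟩ := h
    rw [mem_ball_zero_iff] at hw
    rw [pinch_apply_of_lt hφ hw, OnePoint.coe_eq_coe, smul_eq_zero] at hx
    rcases hx with hx | hx
    · exact absurd hx (inv_ne_zero (by linarith))
    · rw [hx]
  · rw [pinch_of_not_mem hφ h] at hx
    exact absurd hx (OnePoint.infty_ne_coe 0)

/-- **The pinch map is continuous.** [folklore] -/
theorem continuous_pinch [ProperSpace E] [T2Space M] (hφ : IsOpenEmbedding φ) :
    Continuous (pinch hφ) := by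
  have hψ := continuousOn_chartInv hφ
  have hsub : φ '' ball (0 : E) 1 ⊆ range φ := image_subset_range _ _
  refine continuous_coeOrInfty (isOpen_image_ball hφ 1) ?_ ?_
  · -- continuity of the finite part on the open ball
    refine ContinuousOn.smul (ContinuousOn.inv₀ (continuousOn_const.sub (hψ.mono hsub).norm) ?_)
      (hψ.mono hsub)
    rintro _ ⟨w, hw, rfl⟩
    rw [mem_ball_zero_iff] at hw
    rw [chartInv_apply]
    linarith
  · intro a ha
    by_cases hac : a ∈ φ '' closedBall (0 : E) 1
    · -- `a = φ w` with `‖w‖ = 1`: the finite part blows up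
      obtain ⟨w, hw, rfl⟩ := hac
      have hw1 : ‖w‖ = 1 := by
        rw [mem_closedBall_zero_iff] at hw
        rw [apply_mem_image_iff hφ, mem_ball_zero_iff, not_lt] at ha
        exact le_antisymm hw ha
      have hψw : Tendsto (chartInv hφ) (𝓝[φ '' ball (0 : E) 1] (φ w)) (𝓝 w) := by
        have := (hψ (φ w) (mem_range_self w)).mono_left (nhdsWithin_mono _ hsub)
        simpa [ContinuousWithinAt] using this
      have hnorm : Tendsto (fun x => ‖chartInv hφ x‖) (𝓝[φ '' ball (0 : E) 1] (φ w)) (𝓝 1) := by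
        have := hψw.norm
        rwa [hw1] at this
      have hden : Tendsto (fun x => 1 - ‖chartInv hφ x‖) (𝓝[φ '' ball (0 : E) 1] (φ w))
          (𝓝[>] 0) := by
        rw [tendsto_nhdsWithin_iff]
        refine ⟨by simpa using (tendsto_const_nhds (x := (1 : ℝ))).sub hnorm, ?_⟩
        refine eventually_mem_nhdsWithin.mono ?_
        rintro _ ⟨v, hv, rfl⟩
        rw [mem_ball_zero_iff] at hv
        simp only [chartInv_apply, mem_Ioi]
        linarith
      have hinv := tendsto_inv_nhdsGT_zero.comp hden
      refine (hinv.atTop_mul_pos one_pos hnorm).congr' ?_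
      refine eventually_mem_nhdsWithin.mono ?_
      rintro _ ⟨v, hv, rfl⟩
      rw [mem_ball_zero_iff] at hv
      simp only [Function.comp_apply, pinchFin, chartInv_apply, norm_smul, norm_inv,
        Real.norm_eq_abs, abs_of_pos (by linarith : (0 : ℝ) < 1 - ‖v‖)]
    · -- `a` outside the closed ball: not in the closure of the open ball
      refine tendsto_atTop_of_not_mem_closure (fun h => hac ?_) _
      exact closure_minimal (image_mono ball_subset_closedBall)
        (isClosed_image_closedBall hφ 1) h

/-! #### The punctured space and the cone map -/

/-- The punctured space `M ∖ {φ 0}` as a type. [folklore] -/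
abbrev Compl (φ : E → M) : Type _ := ↥(({φ 0}ᶜ : Set M))

section Cone

variable [ContractibleSpace (Compl φ)]

/-- The centre `c₀ ∈ M ∖ {φ 0}` of the chosen contraction of `M ∖ {φ 0}`. [folklore] -/
def center (φ : E → M) [ContractibleSpace (Compl φ)] : Compl φ := ctrCenter (Compl φ)

/-- The chosen contraction `C : [0,1] × (M ∖ {φ 0}) → M ∖ {φ 0}` (`C₀ = id`, `C₁ = c₀`).
[folklore] -/
def ctr (φ : E → M) [ContractibleSpace (Compl φ)] : C(I × Compl φ, Compl φ) := ctrMap (Compl φ)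

omit [NormedSpace ℝ E] in
/-- `C (0, x) = x`. [folklore] -/
@[simp] theorem ctr_zero (x : Compl φ) : ctr φ (0, x) = x := ctrMap_zero x

omit [NormedSpace ℝ E] in
/-- `C (1, x) = c₀`. [folklore] -/
@[simp] theorem ctr_one (x : Compl φ) : ctr φ (1, x) = center φ := ctrMap_one x

/-- The radial projection to the unit chart sphere, as a point of `M ∖ {φ 0}`:
`w ↦ φ (w / ‖w‖)` (junk value `c₀` at `w = 0`). [folklore] -/
def toSphere (hφ : IsOpenEmbedding φ) (w : E) : Compl φ :=
  if h : w = 0 then center φ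
  else ⟨φ (‖w‖⁻¹ • w), apply_mem_compl hφ (smul_ne_zero (inv_ne_zero (norm_ne_zero_iff.2 h)) h)⟩

/-- The value of `toSphere` off the origin. [folklore] -/
theorem coe_toSphere (hφ : IsOpenEmbedding φ) {w : E} (hw : w ≠ 0) :
    (toSphere hφ w : M) = φ (‖w‖⁻¹ • w) := by
  simp [toSphere, hw]

/-- `toSphere` is continuous off the origin. [folklore] -/
theorem continuousOn_toSphere (hφ : IsOpenEmbedding φ) :
    ContinuousOn (toSphere hφ) {w : E | w ≠ 0} := by
  rw [IsInducing.subtypeVal.continuousOn_iff]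
  have : EqOn (Subtype.val ∘ toSphere hφ) (fun w => φ (‖w‖⁻¹ • w)) {w : E | w ≠ 0} :=
    fun w hw => coe_toSphere hφ hw
  refine ContinuousOn.congr ?_ this
  exact hφ.continuous.comp_continuousOn
    ((continuousOn_id.norm.inv₀ fun w hw => norm_ne_zero_iff.2 hw).smul continuousOn_id)

/-- `toSphere` only depends on the direction: `toSphere w = toSphere (w / ‖w‖)`. [folklore] -/
theorem toSphere_mem_image_sphere (hφ : IsOpenEmbedding φ) {w : E} (hw : w ≠ 0) :
    toSphere hφ w ∈ toSphere hφ '' sphere (0 : E) 1 := by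
  have hn : ‖w‖ ≠ 0 := norm_ne_zero_iff.2 hw
  have hu : ‖w‖⁻¹ • w ∈ sphere (0 : E) 1 := by
    rw [mem_sphere_zero_iff_norm, norm_smul, norm_inv, norm_norm, inv_mul_cancel₀ hn]
  have hu0 : ‖w‖⁻¹ • w ≠ 0 := ne_zero_of_mem_unit_sphere ⟨_, hu⟩
  refine ⟨‖w‖⁻¹ • w, hu, Subtype.ext ?_⟩
  rw [coe_toSphere hφ hu0, coe_toSphere hφ hw, mem_sphere_zero_iff_norm.1 hu, inv_one, one_smul]

/-- The finite part of the cone map: `w ↦ φ w` on the closed unit ball,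
`w ↦ C (1 - ‖w‖⁻¹, φ (w/‖w‖))` outside. [folklore] -/
def coneFin (hφ : IsOpenEmbedding φ) (w : E) : M :=
  if ‖w‖ ≤ 1 then φ w else (ctr φ (coneTime w, toSphere hφ w) : M)

/-- **The cone map** `OnePoint E → M`: `coneFin` on `E`, the centre `c₀` at `∞`. [folklore] -/
def cone (hφ : IsOpenEmbedding φ) (z : OnePoint E) : M :=
  z.elim (center φ : M) (coneFin hφ)

/-- The cone map at `∞`. [folklore] -/
@[simp] theorem cone_infty (hφ : IsOpenEmbedding φ) : cone hφ ∞ = (center φ : M) := rfl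

/-- The cone map at finite points. [folklore] -/
@[simp] theorem cone_coe (hφ : IsOpenEmbedding φ) (w : E) : cone hφ w = coneFin hφ w := rfl

/-- The cone map on the closed unit ball. [folklore] -/
theorem coneFin_of_le (hφ : IsOpenEmbedding φ) {w : E} (hw : ‖w‖ ≤ 1) : coneFin hφ w = φ w := by
  simp [coneFin, hw]

/-- The cone map outside the open unit ball. [folklore] -/
theorem coneFin_of_ge (hφ : IsOpenEmbedding φ) {w : E} (hw : 1 ≤ ‖w‖) :
    coneFin hφ w = (ctr φ (coneTime w, toSphere hφ w) : M) := by
  by_cases h : ‖w‖ ≤ 1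
  · have h1 : ‖w‖ = 1 := le_antisymm h hw
    have hw0 : w ≠ 0 := by
      rw [← norm_ne_zero_iff, h1]; exact one_ne_zero
    rw [coneFin_of_le hφ h, coneTime_of_norm_eq_one h1, ctr_zero, coe_toSphere hφ hw0, h1,
      inv_one, one_smul]
  · simp [coneFin, h]

/-- The finite part of the cone map is continuous. [folklore] -/
theorem continuous_coneFin (hφ : IsOpenEmbedding φ) : Continuous (coneFin hφ) := by
  have h1 : ContinuousOn (coneFin hφ) (closedBall (0 : E) 1) := by
    refine (hφ.continuous.continuousOn).congr fun w hw => ?_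
    exact coneFin_of_le hφ (mem_closedBall_zero_iff.1 hw)
  have h2 : ContinuousOn (coneFin hφ) {w : E | 1 ≤ ‖w‖} := by
    have hsub : {w : E | 1 ≤ ‖w‖} ⊆ {w : E | w ≠ 0} := by
      intro w hw h0
      simp only [mem_setOf_eq, h0, norm_zero] at hw
      exact absurd hw (by norm_num)
    have hc : ContinuousOn (fun w => (ctr φ (coneTime w, toSphere hφ w) : M)) {w : E | 1 ≤ ‖w‖} :=
      continuous_subtype_val.comp_continuousOn ((ctr φ).continuous.comp_continuousOn
        ((continuousOn_coneTime.mono hsub).prodMk ((continuousOn_toSphere hφ).mono hsub)))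
    exact hc.congr fun w hw => coneFin_of_ge hφ hw
  have h := h1.union_of_isClosed h2 isClosed_closedBall (isClosed_le continuous_const continuous_norm)
  have huniv : closedBall (0 : E) 1 ∪ {w : E | 1 ≤ ‖w‖} = univ := by
    refine eq_univ_of_forall fun w => ?_
    rcases le_total ‖w‖ 1 with hw | hw
    · exact Or.inl (mem_closedBall_zero_iff.2 hw)
    · exact Or.inr hw
  rw [huniv] at h
  exact continuousOn_univ.1 h

/-- **The cone map tends to the centre at infinity** (tube lemma over the compact chart sphere).
[folklore] -/
theorem tendsto_coneFin_cocompact [ProperSpace E] (hφ : IsOpenEmbedding φ) :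
    Tendsto (coneFin hφ) (cocompact E) (𝓝 (center φ : M)) := by
  set K : Set (Compl φ) := toSphere hφ '' sphere (0 : E) 1 with hK
  have hKc : IsCompact K := by
    refine (isCompact_sphere (0 : E) 1).image_of_continuousOn ((continuousOn_toSphere hφ).mono ?_)
    intro u hu
    exact ne_zero_of_mem_unit_sphere ⟨u, hu⟩
  rw [_root_.tendsto_nhds]
  intro U hU hcU
  -- tube lemma: `C (t, y) ∈ U` for `t` near `1` and all `y ∈ K`
  have htube : ∀ᶠ t in 𝓝 (1 : I), ∀ y ∈ K, (ctr φ (t, y) : M) ∈ U := by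
    refine hKc.eventually_forall_of_forall_eventually fun y _ => ?_
    have hc : Continuous fun q : I × Compl φ => (ctr φ q : M) :=
      continuous_subtype_val.comp (ctr φ).continuous
    have : (fun q : I × Compl φ => (ctr φ q : M)) ⁻¹' U ∈ 𝓝 ((1 : I), y) :=
      hc.continuousAt.preimage_mem_nhds (hU.mem_nhds (by simpa using hcU))
    exact this
  have hev1 := (tendsto_coneTime_cocompact (E := E)).eventually htube
  have hev2 : ∀ᶠ w in cocompact E, 1 < ‖w‖ :=
    tendsto_norm_cocompact_atTop.eventually (eventually_gt_atTop 1)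
  filter_upwards [hev1, hev2] with w h1 h2
  have hw0 : w ≠ 0 := by
    rw [← norm_ne_zero_iff]; exact (one_pos.trans h2).ne'
  rw [mem_preimage, coneFin_of_ge hφ h2.le]
  exact h1 _ (toSphere_mem_image_sphere hφ hw0)

/-- **The cone map is continuous.** [folklore] -/
theorem continuous_cone [ProperSpace E] (hφ : IsOpenEmbedding φ) : Continuous (cone hφ) := by
  rw [OnePoint.continuous_iff]
  refine ⟨?_, continuous_coneFin hφ⟩
  rw [Filter.coclosedCompact_eq_cocompact]
  exact tendsto_coneFin_cocompact hφ

/-- The cone map avoids the centre `φ 0` off the open unit ball. [folklore] -/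
theorem cone_mem_compl (hφ : IsOpenEmbedding φ) {z : OnePoint E}
    (hz : z ∉ ((↑) : E → OnePoint E) '' ball (0 : E) 1) : cone hφ z ∈ ({φ 0}ᶜ : Set M) := by
  induction z using OnePoint.rec with
  | infty => exact (center φ).2
  | coe w =>
    have hw : 1 ≤ ‖w‖ := by
      rw [OnePoint.coe_injective.mem_set_image, mem_ball_zero_iff, not_lt] at hz
      exact hz
    rw [cone_coe, coneFin_of_ge hφ hw]
    exact (ctr φ _).2

/-! #### The homotopy `id ≃ cone ∘ pinch` on `M` -/

/-- The chart dilation of the first homotopy, as a point of `M ∖ {φ 0}`: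
`(s, x) ↦ φ (((1-s) + s ‖ψ x‖⁻¹) • ψ x)` (junk value `c₀` where `ψ x = 0`). [folklore] -/
def dilate (hφ : IsOpenEmbedding φ) (q : I × M) : Compl φ :=
  if h : chartInv hφ q.2 = 0 then center φ
  else ⟨φ ((((1 : ℝ) - q.1) + q.1 * ‖chartInv hφ q.2‖⁻¹) • chartInv hφ q.2), by
    refine apply_mem_compl hφ (smul_ne_zero ?_ h)
    have hs0 : (0 : ℝ) ≤ q.1 := q.1.2.1
    have hs1 : (q.1 : ℝ) ≤ 1 := q.1.2.2
    have hn : 0 < ‖chartInv hφ q.2‖⁻¹ := inv_pos.2 (norm_pos_iff.2 h)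
    have : 0 ≤ (q.1 : ℝ) * ‖chartInv hφ q.2‖⁻¹ := mul_nonneg hs0 hn.le
    rcases eq_or_lt_of_le hs1 with h1 | h1
    · rw [h1]; positivity
    · exact (by nlinarith : (0 : ℝ) < (1 - q.1) + q.1 * ‖chartInv hφ q.2‖⁻¹).ne'⟩

/-- The value of `dilate` at `(s, φ w)`, `w ≠ 0`. [folklore] -/
theorem coe_dilate (hφ : IsOpenEmbedding φ) (s : I) {w : E} (hw : w ≠ 0) :
    (dilate hφ (s, φ w) : M) = φ ((((1 : ℝ) - s) + s * ‖w‖⁻¹) • w) := by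
  simp [dilate, hw]

/-- `dilate` is continuous on `[0,1] × φ (E ∖ 0)`. [folklore] -/
theorem continuousOn_dilate (hφ : IsOpenEmbedding φ) :
    ContinuousOn (dilate hφ) (univ ×ˢ (φ '' {w : E | w ≠ 0})) := by
  rw [IsInducing.subtypeVal.continuousOn_iff]
  have hψ : ContinuousOn (fun q : I × M => chartInv hφ q.2) (univ ×ˢ (φ '' {w : E | w ≠ 0})) :=
    (continuousOn_chartInv hφ).comp continuous_snd.continuousOn
      (fun q hq => image_subset_range _ _ hq.2)
  have hne : ∀ q ∈ univ ×ˢ (φ '' {w : E | w ≠ 0}), chartInv hφ (q : I × M).2 ≠ 0 := by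
    rintro ⟨s, _⟩ ⟨-, ⟨w, hw, rfl⟩⟩
    simpa using hw
  have heq : EqOn (Subtype.val ∘ dilate hφ)
      (fun q : I × M => φ ((((1 : ℝ) - q.1) + q.1 * ‖chartInv hφ q.2‖⁻¹) • chartInv hφ q.2))
      (univ ×ˢ (φ '' {w : E | w ≠ 0})) := by
    rintro ⟨s, _⟩ ⟨-, ⟨w, hw, rfl⟩⟩
    simp [coe_dilate hφ s hw]
  refine ContinuousOn.congr ?_ heq
  refine hφ.continuous.comp_continuousOn (ContinuousOn.smul ?_ hψ)
  have hs : Continuous fun q : I × M => (q.1 : ℝ) := continuous_subtype_val.comp continuous_fst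
  exact (continuous_const.sub hs).continuousOn.add
    (hs.continuousOn.mul (hψ.norm.inv₀ fun q hq => norm_ne_zero_iff.2 (hne q hq)))

/-- Branch 1 of the first homotopy (on `φ (closedBall 0 (1/2))`):
`(s, x) ↦ φ (((1-s) + s (1 - ‖ψ x‖)⁻¹) • ψ x)`. [folklore] -/
def homA (hφ : IsOpenEmbedding φ) (q : I × M) : M :=
  φ ((((1 : ℝ) - q.1) + q.1 * (1 - ‖chartInv hφ q.2‖)⁻¹) • chartInv hφ q.2)

/-- Branch 2 of the first homotopy (on `φ {1/2 ≤ ‖w‖ ≤ 1}`):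
`(s, x) ↦ C (s (2 - ‖ψ x‖⁻¹), φ (((1-s) + s ‖ψ x‖⁻¹) • ψ x))`. [folklore] -/
def homB (hφ : IsOpenEmbedding φ) (q : I × M) : M :=
  (ctr φ (clampI ((q.1 : ℝ) * (2 - ‖chartInv hφ q.2‖⁻¹)), dilate hφ q) : M)

/-- The point `x` as a point of `M ∖ {φ 0}` (junk value `c₀` at `x = φ 0`). [folklore] -/
def toCompl (φ : E → M) [ContractibleSpace (Compl φ)] (x : M) : Compl φ :=
  if h : x = φ 0 then center φ else ⟨x, h⟩

/-- Branch 3 of the first homotopy (off `φ (ball 0 1)`): `(s, x) ↦ C (s, x)`. [folklore] -/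
def homC (φ : E → M) [ContractibleSpace (Compl φ)] (q : I × M) : M :=
  (ctr φ (q.1, toCompl φ q.2) : M)

/-- **The first homotopy** `G : [0,1] × M → M` (from `id` to `cone ∘ pinch`). [folklore] -/
def homG (hφ : IsOpenEmbedding φ) (q : I × M) : M :=
  if q.2 ∈ φ '' closedBall (0 : E) (1 / 2) then homA hφ q
  else if q.2 ∈ φ '' closedBall (0 : E) 1 then homB hφ q else homC φ q

omit [TopologicalSpace M] [NormedSpace ℝ E] [ContractibleSpace (Compl φ)] in
/-- The three closed pieces of `[0,1] × M` used for `G`. [folklore] -/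
theorem homG_cover (q : I × M) :
    q ∈ (univ : Set I) ×ˢ (φ '' closedBall (0 : E) (1 / 2)) ∨
      q ∈ (univ : Set I) ×ˢ (φ '' (closedBall (0 : E) 1 ∩ {w | 1 / 2 ≤ ‖w‖})) ∨
        q ∈ (univ : Set I) ×ˢ (φ '' ball (0 : E) 1)ᶜ := by
  by_cases h : q.2 ∈ φ '' ball (0 : E) 1
  · obtain ⟨w, hw, hq⟩ := h
    rw [mem_ball_zero_iff] at hw
    rcases le_or_gt ‖w‖ (1 / 2) with h2 | h2
    · exact Or.inl ⟨mem_univ _, w, mem_closedBall_zero_iff.2 h2, hq⟩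
    · exact Or.inr (Or.inl ⟨mem_univ _, w, ⟨mem_closedBall_zero_iff.2 hw.le, h2.le⟩, hq⟩)
  · exact Or.inr (Or.inr ⟨mem_univ _, h⟩)

/-- `G = homA` on piece 1. [folklore] -/
theorem homG_eq_homA (hφ : IsOpenEmbedding φ) {q : I × M}
    (hq : q.2 ∈ φ '' closedBall (0 : E) (1 / 2)) : homG hφ q = homA hφ q := by
  unfold homG
  rw [if_pos hq]

/-- `G = homB` on piece 2. [folklore] -/
theorem homG_eq_homB (hφ : IsOpenEmbedding φ) {s : I} {w : E} (hw1 : ‖w‖ ≤ 1)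
    (hw2 : 1 / 2 ≤ ‖w‖) : homG hφ (s, φ w) = homB hφ (s, φ w) := by
  have hw0 : w ≠ 0 := by
    rw [← norm_ne_zero_iff]; exact (lt_of_lt_of_le (by norm_num) hw2).ne'
  by_cases h : φ w ∈ φ '' closedBall (0 : E) (1 / 2)
  · -- on the sphere of radius `1/2` the two branches agree
    have h12 : ‖w‖ = 1 / 2 := by
      rw [apply_mem_image_iff hφ, mem_closedBall_zero_iff] at h
      exact le_antisymm h hw2
    rw [homG_eq_homA hφ h]
    simp only [homA, homB, chartInv_apply, h12]
    have hc : clampI ((s : ℝ) * (2 - (1 / 2 : ℝ)⁻¹)) = 0 := by norm_num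
    rw [hc, ctr_zero, coe_dilate hφ s hw0, h12]
    norm_num
  · unfold homG
    rw [if_neg h, if_pos ((apply_mem_image_iff hφ).2 (mem_closedBall_zero_iff.2 hw1))]

omit [NormedSpace ℝ E] in
/-- `toCompl x = x` off the centre. [folklore] -/
theorem toCompl_of_ne {x : M} (hx : x ≠ φ 0) : toCompl φ x = ⟨x, hx⟩ := by
  simp [toCompl, hx]

/-- `G = homC` on piece 3. [folklore] -/
theorem homG_eq_homC (hφ : IsOpenEmbedding φ) {q : I × M} (hq : q.2 ∉ φ '' ball (0 : E) 1) :
    homG hφ q = homC φ q := by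
  obtain ⟨s, x⟩ := q
  have h1 : x ∉ φ '' closedBall (0 : E) (1 / 2) := fun h =>
    hq (image_mono (closedBall_subset_ball (by norm_num)) h)
  by_cases h2 : x ∈ φ '' closedBall (0 : E) 1
  · obtain ⟨w, hw, rfl⟩ := h2
    have hw1 : ‖w‖ = 1 := by
      rw [mem_closedBall_zero_iff] at hw
      rw [apply_mem_image_iff hφ, mem_ball_zero_iff, not_lt] at hq
      exact le_antisymm hw hq
    have hw0 : w ≠ 0 := by
      rw [← norm_ne_zero_iff, hw1]; exact one_ne_zero
    rw [homG_eq_homB hφ hw1.le (by rw [hw1]; norm_num)]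
    simp only [homB, homC, chartInv_apply, hw1, inv_one]
    have hc : clampI ((s : ℝ) * (2 - 1)) = s := by norm_num
    have hd : dilate hφ (s, φ w) = ⟨φ w, apply_mem_compl hφ hw0⟩ :=
      Subtype.ext (by rw [coe_dilate hφ s hw0, hw1]; norm_num)
    rw [hc, toCompl_of_ne (apply_mem_compl hφ hw0), hd]
  · unfold homG
    rw [if_neg h1, if_neg h2]

/-- **The first homotopy is continuous** (pasting on three closed pieces). [folklore] -/
theorem continuous_homG [ProperSpace E] [T2Space M] (hφ : IsOpenEmbedding φ) :
    Continuous (homG hφ) := by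
  have hψ := continuousOn_chartInv hφ
  have hs : Continuous fun q : I × M => (q.1 : ℝ) := continuous_subtype_val.comp continuous_fst
  -- the three closed pieces
  set C₁ : Set (I × M) := (univ : Set I) ×ˢ (φ '' closedBall (0 : E) (1 / 2)) with hC₁
  set C₂ : Set (I × M) := (univ : Set I) ×ˢ (φ '' (closedBall (0 : E) 1 ∩ {w | 1 / 2 ≤ ‖w‖}))
    with hC₂
  set C₃ : Set (I × M) := (univ : Set I) ×ˢ (φ '' ball (0 : E) 1)ᶜ with hC₃
  have hc₁ : IsClosed C₁ := isClosed_univ.prod (isClosed_image_closedBall hφ _)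
  have hc₂ : IsClosed C₂ := by
    refine isClosed_univ.prod (IsCompact.isClosed ?_)
    exact ((isCompact_closedBall (0 : E) 1).inter_right
      (isClosed_le continuous_const continuous_norm)).image hφ.continuous
  have hc₃ : IsClosed C₃ := isClosed_univ.prod (isOpen_image_ball hφ 1).isClosed_compl
  -- piece 1
  have h₁ : ContinuousOn (homG hφ) C₁ := by
    have hψ₁ : ContinuousOn (fun q : I × M => chartInv hφ q.2) C₁ :=
      hψ.comp continuous_snd.continuousOn fun q hq => image_subset_range _ _ hq.2
    have hA : ContinuousOn (homA hφ) C₁ := by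
      refine hφ.continuous.comp_continuousOn (ContinuousOn.smul ?_ hψ₁)
      refine (continuous_const.sub hs).continuousOn.add (hs.continuousOn.mul ?_)
      refine (continuousOn_const.sub hψ₁.norm).inv₀ ?_
      rintro ⟨t, _⟩ ⟨-, ⟨w, hw, rfl⟩⟩
      rw [mem_closedBall_zero_iff] at hw
      show 1 - ‖chartInv hφ (φ w)‖ ≠ 0
      rw [chartInv_apply]
      linarith
    exact hA.congr fun q hq => homG_eq_homA hφ hq.2
  -- piece 2
  have h₂ : ContinuousOn (homG hφ) C₂ := by
    have hsub : C₂ ⊆ univ ×ˢ (φ '' {w : E | w ≠ 0}) := by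
      rintro ⟨t, x⟩ ⟨-, ⟨w, hw, rfl⟩⟩
      refine ⟨mem_univ _, w, ?_, rfl⟩
      rw [mem_setOf_eq, ← norm_ne_zero_iff]
      exact (lt_of_lt_of_le (by norm_num) hw.2).ne'
    have hψ₂ : ContinuousOn (fun q : I × M => chartInv hφ q.2) C₂ :=
      hψ.comp continuous_snd.continuousOn fun q hq => image_subset_range _ _ hq.2
    have hB : ContinuousOn (homB hφ) C₂ := by
      refine continuous_subtype_val.comp_continuousOn ((ctr φ).continuous.comp_continuousOn ?_)
      refine ContinuousOn.prodMk ?_ ((continuousOn_dilate hφ).mono hsub)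
      refine continuous_clampI.comp_continuousOn (hs.continuousOn.mul ?_)
      refine continuousOn_const.sub (hψ₂.norm.inv₀ ?_)
      rintro ⟨t, _⟩ ⟨-, ⟨w, hw, rfl⟩⟩
      show ‖chartInv hφ (φ w)‖ ≠ 0
      rw [chartInv_apply]
      exact (lt_of_lt_of_le (by norm_num) hw.2).ne'
    refine hB.congr ?_
    rintro ⟨t, _⟩ ⟨-, ⟨w, hw, rfl⟩⟩
    exact homG_eq_homB hφ (mem_closedBall_zero_iff.1 hw.1) hw.2
  -- piece 3
  have h₃ : ContinuousOn (homG hφ) C₃ := by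
    have hne : ∀ q ∈ C₃, (q : I × M).2 ≠ φ 0 := by
      rintro ⟨t, x⟩ ⟨-, hx⟩ (h : x = φ 0)
      exact hx (h ▸ ⟨0, mem_ball_self one_pos, rfl⟩)
    have hT : ContinuousOn (fun q : I × M => toCompl φ q.2) C₃ := by
      rw [IsInducing.subtypeVal.continuousOn_iff]
      exact continuous_snd.continuousOn.congr fun q hq => by
        simp [toCompl_of_ne (hne q hq)]
    have hC : ContinuousOn (homC φ) C₃ :=
      continuous_subtype_val.comp_continuousOn ((ctr φ).continuous.comp_continuousOn
        (continuous_fst.continuousOn.prodMk hT))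
    exact hC.congr fun q hq => homG_eq_homC hφ hq.2
  have h := (h₁.union_of_isClosed h₂ hc₁ hc₂).union_of_isClosed h₃ (hc₁.union hc₂) hc₃
  have huniv : C₁ ∪ C₂ ∪ C₃ = univ := by
    refine eq_univ_of_forall fun q => ?_
    rcases homG_cover (φ := φ) q with hq | hq | hq
    · exact Or.inl (Or.inl hq)
    · exact Or.inl (Or.inr hq)
    · exact Or.inr hq
  rw [huniv] at h
  exact continuousOn_univ.1 h

/-- `G (0, x) = x`. [folklore] -/
theorem homG_zero (hφ : IsOpenEmbedding φ) (x : M) : homG hφ (0, x) = x := by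
  rcases homG_cover (φ := φ) ((0 : I), x) with ⟨-, hx⟩ | ⟨-, hx⟩ | ⟨-, hx⟩
  · rw [homG_eq_homA hφ hx]
    obtain ⟨w, -, rfl⟩ := hx
    simp [homA]
  · obtain ⟨w, hw, rfl⟩ := hx
    have hw0 : w ≠ 0 := by
      rw [← norm_ne_zero_iff]; exact (lt_of_lt_of_le (by norm_num) hw.2).ne'
    rw [homG_eq_homB hφ (mem_closedBall_zero_iff.1 hw.1) hw.2]
    simp only [homB, Set.Icc.coe_zero, zero_mul, clampI_zero, ctr_zero, coe_dilate hφ 0 hw0]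
    simp
  · rw [homG_eq_homC hφ hx]
    have hx0 : x ≠ φ 0 := fun h => hx (h ▸ ⟨0, mem_ball_self one_pos, rfl⟩)
    simp [homC, toCompl_of_ne hx0]

/-- `G (1, x) = cone (pinch x)`. [folklore] -/
theorem homG_one (hφ : IsOpenEmbedding φ) (x : M) : homG hφ (1, x) = cone hφ (pinch hφ x) := by
  rcases homG_cover (φ := φ) ((1 : I), x) with ⟨-, hx⟩ | ⟨-, hx⟩ | ⟨-, hx⟩
  · -- `‖w‖ ≤ 1/2`: the pinched point lies in the closed unit ball
    rw [homG_eq_homA hφ hx]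
    obtain ⟨w, hw, rfl⟩ := hx
    rw [mem_closedBall_zero_iff] at hw
    have hlt : ‖w‖ < 1 := by linarith
    have hv : ‖(1 - ‖w‖)⁻¹ • w‖ ≤ 1 := by
      rw [norm_smul, norm_inv, Real.norm_eq_abs, abs_of_pos (by linarith), inv_mul_le_iff₀ (by linarith)]
      linarith
    rw [pinch_apply_of_lt hφ hlt, cone_coe, coneFin_of_le hφ hv]
    simp [homA]
  · obtain ⟨w, hw, rfl⟩ := hx
    have hw1 := mem_closedBall_zero_iff.1 hw.1
    have hw2 : 1 / 2 ≤ ‖w‖ := hw.2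
    have hw0 : w ≠ 0 := by
      rw [← norm_ne_zero_iff]; exact (lt_of_lt_of_le (by norm_num) hw2).ne'
    have hn0 : ‖w‖ ≠ 0 := norm_ne_zero_iff.2 hw0
    rw [homG_eq_homB hφ hw1 hw2]
    rcases hw1.lt_or_eq with hlt | h1
    · -- `1/2 ≤ ‖w‖ < 1`: the pinched point lies outside the open unit ball
      have hpos : 0 < 1 - ‖w‖ := by linarith
      have hvn : ‖(1 - ‖w‖)⁻¹ • w‖ = (1 - ‖w‖)⁻¹ * ‖w‖ := by
        rw [norm_smul, norm_inv, Real.norm_eq_abs, abs_of_pos hpos]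
      have hv : 1 ≤ ‖(1 - ‖w‖)⁻¹ • w‖ := by
        rw [hvn, le_inv_mul_iff₀ hpos]
        linarith
      have hv0 : (1 - ‖w‖)⁻¹ • w ≠ 0 := by
        rw [← norm_ne_zero_iff]; exact (one_pos.trans_le hv).ne'
      -- the time parameters agree: `2 - ‖w‖⁻¹ = 1 - ‖v‖⁻¹`
      have ht : clampI ((1 : ℝ) * (2 - ‖w‖⁻¹)) = coneTime ((1 - ‖w‖)⁻¹ • w) := by
        simp only [coneTime, hvn, one_mul]
        congr 1
        field_simp
        ring
      -- the sphere points agree: `v / ‖v‖ = w / ‖w‖`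
      have hd : dilate hφ (1, φ w) = toSphere hφ ((1 - ‖w‖)⁻¹ • w) := by
        apply Subtype.ext
        rw [coe_dilate hφ 1 hw0, coe_toSphere hφ hv0, hvn, smul_smul]
        congr 1
        simp only [Set.Icc.coe_one, sub_self, one_mul, zero_add]
        field_simp
      rw [pinch_apply_of_lt hφ hlt, cone_coe, coneFin_of_ge hφ hv]
      simp only [homB, chartInv_apply]
      rw [← ht, hd, Set.Icc.coe_one]
    · -- `‖w‖ = 1`: both sides are the centre
      rw [pinch_apply_of_le hφ h1.ge, cone_infty]
      simp only [homB, Set.Icc.coe_one, one_mul, chartInv_apply, h1, inv_one]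
      norm_num
  · rw [homG_eq_homC hφ hx, pinch_of_not_mem hφ hx, cone_infty]
    simp [homC]

end Cone

/-! #### Dilations of `OnePoint E` fixing `∞` -/

section Dilation

variable (E)

/-- The open set `{(s, z) | s < 1, z ≠ ∞}` where the dilation is finite. [folklore] -/
def dilSet : Set (I × OnePoint E) := {q | (q.1 : ℝ) < 1 ∧ q.2 ≠ ∞}

/-- **The dilations** `Φ_s (v) = (1 - s)⁻¹ • v` of `OnePoint E` (`Φ_s ∞ = ∞`, `Φ₁ = ∞`): a
contraction of `OnePoint E ∖ {0}` to `∞` fixing `∞`. [folklore] -/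
def dil (q : I × OnePoint E) : OnePoint E :=
  coeOrInfty (dilSet E) (fun q => ((1 : ℝ) - q.1)⁻¹ • elim0 q.2) q

variable {E}

omit [NormedSpace ℝ E] in
/-- `dilSet` is open. [folklore] -/
theorem isOpen_dilSet : IsOpen (dilSet E) :=
  (isOpen_lt (continuous_subtype_val.comp continuous_fst) continuous_const).inter
    (isOpen_ne_infty.preimage continuous_snd)

/-- `Φ₀ = id`. [folklore] -/
theorem dil_zero (z : OnePoint E) : dil E (0, z) = z := by
  induction z using OnePoint.rec with
  | infty => exact coeOrInfty_of_not_mem (fun h => h.2 rfl)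
  | coe v =>
    rw [dil, coeOrInfty_of_mem (show ((0 : I), (v : OnePoint E)) ∈ dilSet E from
      ⟨by norm_num, OnePoint.coe_ne_infty v⟩)]
    simp

/-- `Φ₁ = ∞`. [folklore] -/
theorem dil_one (z : OnePoint E) : dil E (1, z) = ∞ :=
  coeOrInfty_of_not_mem fun h => by simp [dilSet] at h

/-- `Φ_s ∞ = ∞`. [folklore] -/
theorem dil_infty (s : I) : dil E (s, ∞) = ∞ :=
  coeOrInfty_of_not_mem fun h => h.2 rfl

/-- **The dilations are continuous off the origin** `{(s, z) | z ≠ 0}`. [folklore] -/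
theorem continuousOn_dil [ProperSpace E] :
    ContinuousOn (dil E) {q : I × OnePoint E | q.2 ≠ ((0 : E) : OnePoint E)} := by
  set S : Set (I × OnePoint E) := {q | q.2 ≠ ((0 : E) : OnePoint E)} with hS
  have hs : Continuous fun q : I × OnePoint E => (q.1 : ℝ) :=
    continuous_subtype_val.comp continuous_fst
  have helim : ContinuousOn (fun q : I × OnePoint E => elim0 q.2) (S ∩ dilSet E) :=
    continuousOn_elim0.comp continuous_snd.continuousOn fun q hq => hq.2.2
  refine continuousOn_coeOrInfty isOpen_dilSet ?_ ?_
  · refine ContinuousOn.smul ?_ helim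
    refine ((continuous_const.sub hs).continuousOn).inv₀ ?_
    rintro q ⟨-, hq, -⟩
    exact (sub_pos.2 hq).ne'
  · rintro ⟨s, z⟩ hzS hq
    -- lower bound `‖elim0 z‖ ≤ ‖(1 - s)⁻¹ • elim0 z‖` on `dilSet`
    have hle : ∀ q ∈ S ∩ dilSet E,
        ‖elim0 (q : I × OnePoint E).2‖ ≤ ‖((1 : ℝ) - q.1)⁻¹ • elim0 q.2‖ := by
      rintro ⟨t, y⟩ ⟨-, ht, -⟩
      have h1 : 0 < 1 - (t : ℝ) := sub_pos.2 ht
      have h2 : 1 - (t : ℝ) ≤ 1 := by linarith [t.2.1]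
      rw [norm_smul, norm_inv, Real.norm_eq_abs, abs_of_pos h1]
      exact (le_inv_mul_iff₀ h1).2 (by nlinarith [norm_nonneg (elim0 y)])
    induction z using OnePoint.rec with
    | infty =>
      -- near `∞` the underlying point is large
      have h1 : Tendsto (fun q : I × OnePoint E => q.2) (𝓝[S ∩ dilSet E] (s, ∞)) (𝓝[≠] ∞) :=
        continuous_snd.continuousWithinAt.tendsto_nhdsWithin fun q hq => hq.2.2
      have h2 := tendsto_norm_elim0_nhdsWithin_infty.comp h1
      exact tendsto_atTop_mono' _ (eventually_mem_nhdsWithin.mono hle) h2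
    | coe v =>
      have hv : v ≠ 0 := fun h => hzS (by rw [h])
      have hs1 : (s : ℝ) = 1 := by
        by_contra h
        exact hq ⟨lt_of_le_of_ne s.2.2 h, OnePoint.coe_ne_infty v⟩
      -- `(1 - t)⁻¹ → ∞` and `‖elim0 y‖ → ‖v‖ > 0`
      have h1 : Tendsto (fun q : I × OnePoint E => 1 - (q.1 : ℝ)) (𝓝[S ∩ dilSet E] (s, ↑v))
          (𝓝[>] 0) := by
        rw [tendsto_nhdsWithin_iff]
        refine ⟨?_, eventually_mem_nhdsWithin.mono fun q hq => sub_pos.2 hq.2.1⟩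
        have hc : Continuous fun q : I × OnePoint E => (1 : ℝ) - q.1 := continuous_const.sub hs
        have := (hc.tendsto (s, (v : OnePoint E))).mono_left
          (nhdsWithin_le_nhds (s := S ∩ dilSet E))
        simpa [hs1] using this
      have h2 := tendsto_inv_nhdsGT_zero.comp h1
      have h3 : Tendsto (fun q : I × OnePoint E => ‖elim0 q.2‖) (𝓝[S ∩ dilSet E] (s, ↑v))
          (𝓝 ‖v‖) := by
        have hca : ContinuousAt (fun q : I × OnePoint E => elim0 q.2) (s, ↑v) :=
          (continuousAt_elim0 v).comp_of_eq continuous_snd.continuousAt rfl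
        simpa using (hca.tendsto.mono_left nhdsWithin_le_nhds).norm
      have h4 := h2.atTop_mul_pos (norm_pos_iff.2 hv) h3
      refine h4.congr' (eventually_mem_nhdsWithin.mono ?_)
      rintro ⟨t, y⟩ ⟨-, ht, -⟩
      simp [norm_smul, abs_of_pos (sub_pos.2 ht)]

end Dilation

/-! #### The homotopy `pinch ∘ cone ≃ k ≃ id` on `OnePoint E` -/

section Right

variable [ContractibleSpace (Compl φ)]

/-- The intermediate map `k`: `pinch ∘ cone` on the closed unit ball, `∞` elsewhere. [folklore] -/
def kMap (hφ : IsOpenEmbedding φ) (z : OnePoint E) : OnePoint E :=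
  if z ∈ ((↑) : E → OnePoint E) '' closedBall (0 : E) 1 then pinch hφ (cone hφ z) else ∞

/-- **The second homotopy** `Ψ : [0,1] × OnePoint E → OnePoint E` (from `pinch ∘ cone` to `k`):
`pinch ∘ cone` on the closed unit ball, dilated elsewhere. [folklore] -/
def homPsi (hφ : IsOpenEmbedding φ) (q : I × OnePoint E) : OnePoint E :=
  if q.2 ∈ ((↑) : E → OnePoint E) '' closedBall (0 : E) 1 then pinch hφ (cone hφ q.2)
  else dil E (q.1, pinch hφ (cone hφ q.2))

/-- `pinch (cone w) = ∞` on the unit sphere. [folklore] -/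
theorem pinch_cone_of_norm_eq_one (hφ : IsOpenEmbedding φ) {w : E} (hw : ‖w‖ = 1) :
    pinch hφ (cone hφ w) = ∞ := by
  rw [cone_coe, coneFin_of_le hφ hw.le, pinch_apply_of_le hφ hw.ge]

/-- `Ψ` is continuous. [folklore] -/
theorem continuous_homPsi [ProperSpace E] [T2Space M] (hφ : IsOpenEmbedding φ) :
    Continuous (homPsi hφ) := by
  have hpc : Continuous fun z : OnePoint E => pinch hφ (cone hφ z) :=
    (continuous_pinch hφ).comp (continuous_cone hφ)
  set D₁ : Set (I × OnePoint E) := (univ : Set I) ×ˢ (((↑) : E → OnePoint E) '' closedBall 0 1)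
  set D₂ : Set (I × OnePoint E) := (univ : Set I) ×ˢ (((↑) : E → OnePoint E) '' ball 0 1)ᶜ
  have hD₁ : IsClosed D₁ :=
    isClosed_univ.prod ((isCompact_closedBall (0 : E) 1).image OnePoint.continuous_coe).isClosed
  have hD₂ : IsClosed D₂ :=
    isClosed_univ.prod (OnePoint.isOpen_image_coe.2 isOpen_ball).isClosed_compl
  have h₁ : ContinuousOn (homPsi hφ) D₁ :=
    (hpc.comp continuous_snd).continuousOn.congr fun q hq => if_pos hq.2
  have h₂ : ContinuousOn (homPsi hφ) D₂ := by
    have hc : ContinuousOn (fun q : I × OnePoint E => dil E (q.1, pinch hφ (cone hφ q.2))) D₂ := by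
      refine continuousOn_dil.comp (continuous_fst.prodMk (hpc.comp continuous_snd)).continuousOn ?_
      rintro ⟨s, z⟩ ⟨-, hz⟩ h
      exact cone_mem_compl hφ hz (eq_of_pinch_eq_zero hφ h)
    refine hc.congr ?_
    rintro ⟨s, z⟩ ⟨-, hz⟩
    by_cases h : z ∈ ((↑) : E → OnePoint E) '' closedBall (0 : E) 1
    · obtain ⟨w, hw, rfl⟩ := h
      have hw1 : ‖w‖ = 1 := by
        rw [mem_closedBall_zero_iff] at hw
        rw [mem_compl_iff, OnePoint.coe_injective.mem_set_image, mem_ball_zero_iff, not_lt] at hz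
        exact le_antisymm hw hz
      simp only [homPsi, OnePoint.coe_injective.mem_set_image, mem_closedBall_zero_iff, hw1.le,
        if_true, pinch_cone_of_norm_eq_one hφ hw1, dil_infty]
    · exact if_neg h
  have h := h₁.union_of_isClosed h₂ hD₁ hD₂
  have huniv : D₁ ∪ D₂ = univ := by
    refine eq_univ_of_forall fun q => ?_
    by_cases hq : q.2 ∈ ((↑) : E → OnePoint E) '' ball (0 : E) 1
    · exact Or.inl ⟨mem_univ _, image_mono ball_subset_closedBall hq⟩
    · exact Or.inr ⟨mem_univ _, hq⟩
  rw [huniv] at h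
  exact continuousOn_univ.1 h

/-- `Ψ (0, z) = pinch (cone z)`. [folklore] -/
theorem homPsi_zero (hφ : IsOpenEmbedding φ) (z : OnePoint E) :
    homPsi hφ (0, z) = pinch hφ (cone hφ z) := by
  by_cases h : z ∈ ((↑) : E → OnePoint E) '' closedBall (0 : E) 1
  · exact if_pos h
  · rw [homPsi, if_neg h, dil_zero]

/-- `Ψ (1, z) = k z`. [folklore] -/
theorem homPsi_one (hφ : IsOpenEmbedding φ) (z : OnePoint E) : homPsi hφ (1, z) = kMap hφ z := by
  by_cases h : z ∈ ((↑) : E → OnePoint E) '' closedBall (0 : E) 1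
  · rw [homPsi, if_pos h, kMap, if_pos h]
  · rw [homPsi, if_neg h, kMap, if_neg h, dil_one]

variable (E) in
/-- The open set `{(t, z) | z ≠ ∞, t ‖z‖ < 1}` where the radial homotopy is finite. [folklore] -/
def radSet : Set (I × OnePoint E) := {q | q.2 ≠ ∞ ∧ (q.1 : ℝ) * ‖elim0 q.2‖ < 1}

variable (E) in
/-- **The radial homotopy** `K_t (w) = (1 - t ‖w‖)⁻¹ • w` (`= ∞` when `t ‖w‖ ≥ 1` or at `∞`),
from `id` (`t = 0`) to `k` (`t = 1`). [folklore] -/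
def homK (q : I × OnePoint E) : OnePoint E :=
  coeOrInfty (radSet E) (fun q => ((1 : ℝ) - q.1 * ‖elim0 q.2‖)⁻¹ • elim0 q.2) q

omit [NormedSpace ℝ E] [ContractibleSpace (Compl φ)] in
/-- `radSet` is open. [folklore] -/
theorem isOpen_radSet : IsOpen (radSet E) := by
  have hc : ContinuousOn (fun q : I × OnePoint E => (q.1 : ℝ) * ‖elim0 q.2‖) {q | q.2 ≠ ∞} :=
    (continuous_subtype_val.comp continuous_fst).continuousOn.mul
      (continuousOn_elim0.comp continuous_snd.continuousOn fun q hq => hq).norm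
  exact hc.isOpen_inter_preimage (isOpen_ne_infty.preimage continuous_snd)
    (isOpen_Iio : IsOpen (Iio (1 : ℝ)))

omit [ContractibleSpace (Compl φ)] in
/-- `K (0, z) = z`. [folklore] -/
theorem homK_zero (z : OnePoint E) : homK E (0, z) = z := by
  induction z using OnePoint.rec with
  | infty => exact coeOrInfty_of_not_mem fun h => h.1 rfl
  | coe v =>
    rw [homK, coeOrInfty_of_mem (show ((0 : I), (v : OnePoint E)) ∈ radSet E from
      ⟨OnePoint.coe_ne_infty v, by norm_num⟩)]
    simp

omit [ContractibleSpace (Compl φ)] in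
/-- `K (t, ∞) = ∞`. [folklore] -/
theorem homK_infty (t : I) : homK E (t, ∞) = ∞ :=
  coeOrInfty_of_not_mem fun h => h.1 rfl

omit [ContractibleSpace (Compl φ)] in
/-- `K (1, w) = (1 - ‖w‖)⁻¹ • w` on the open unit ball. [folklore] -/
theorem homK_one_of_lt {w : E} (hw : ‖w‖ < 1) :
    homK E (1, w) = (((1 - ‖w‖)⁻¹ • w : E) : OnePoint E) := by
  rw [homK, coeOrInfty_of_mem (show ((1 : I), (w : OnePoint E)) ∈ radSet E from
    ⟨OnePoint.coe_ne_infty w, by simpa using hw⟩)]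
  simp

omit [ContractibleSpace (Compl φ)] in
/-- `K (1, w) = ∞` off the open unit ball. [folklore] -/
theorem homK_one_of_le {w : E} (hw : 1 ≤ ‖w‖) : homK E (1, w) = ∞ :=
  coeOrInfty_of_not_mem fun h => by
    have := h.2
    simp only [Set.Icc.coe_one, elim0_coe, one_mul] at this
    linarith

/-- `K (1, z) = k z`. [folklore] -/
theorem homK_one (hφ : IsOpenEmbedding φ) (z : OnePoint E) : homK E (1, z) = kMap hφ z := by
  induction z using OnePoint.rec with
  | infty =>
    rw [homK_infty, kMap, if_neg OnePoint.infty_notMem_image_coe]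
  | coe w =>
    rcases lt_or_ge ‖w‖ 1 with hw | hw
    · rw [homK_one_of_lt hw, kMap, if_pos ((OnePoint.coe_injective.mem_set_image).2
        (mem_closedBall_zero_iff.2 hw.le)), cone_coe, coneFin_of_le hφ hw.le,
        pinch_apply_of_lt hφ hw]
    · rw [homK_one_of_le hw, kMap]
      by_cases h : (w : OnePoint E) ∈ ((↑) : E → OnePoint E) '' closedBall (0 : E) 1
      · have hw1 : ‖w‖ = 1 :=
          le_antisymm (mem_closedBall_zero_iff.1 ((OnePoint.coe_injective.mem_set_image).1 h)) hw
        rw [if_pos h, pinch_cone_of_norm_eq_one hφ hw1]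
      · rw [if_neg h]

omit [ContractibleSpace (Compl φ)] in
/-- **The radial homotopy is continuous.** [folklore] -/
theorem continuous_homK [ProperSpace E] : Continuous (homK E) := by
  have ht : Continuous fun q : I × OnePoint E => (q.1 : ℝ) :=
    continuous_subtype_val.comp continuous_fst
  have helim : ContinuousOn (fun q : I × OnePoint E => elim0 q.2) (radSet E) :=
    continuousOn_elim0.comp continuous_snd.continuousOn fun q hq => hq.1
  have hden : ContinuousOn (fun q : I × OnePoint E => (1 : ℝ) - q.1 * ‖elim0 q.2‖) (radSet E) :=
    continuousOn_const.sub (ht.continuousOn.mul helim.norm)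
  refine continuous_coeOrInfty isOpen_radSet ?_ ?_
  · exact (hden.inv₀ fun q hq => (sub_pos.2 hq.2).ne').smul helim
  · rintro ⟨t, z⟩ hq
    -- the norm of the finite part on `radSet`
    have hnorm : ∀ q ∈ radSet E, ‖((1 : ℝ) - q.1 * ‖elim0 (q : I × OnePoint E).2‖)⁻¹ • elim0 q.2‖
        = ((1 : ℝ) - q.1 * ‖elim0 q.2‖)⁻¹ * ‖elim0 q.2‖ := by
      intro q hq
      rw [norm_smul, norm_inv, Real.norm_eq_abs, abs_of_pos (sub_pos.2 hq.2)]
    have hle : ∀ q ∈ radSet E, ‖elim0 (q : I × OnePoint E).2‖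
        ≤ ‖((1 : ℝ) - q.1 * ‖elim0 q.2‖)⁻¹ • elim0 q.2‖ := by
      intro q hq
      rw [hnorm q hq]
      have h1 : 0 < (1 : ℝ) - q.1 * ‖elim0 q.2‖ := sub_pos.2 hq.2
      have h2 : (1 : ℝ) - q.1 * ‖elim0 q.2‖ ≤ 1 := by
        have := mul_nonneg q.1.2.1 (norm_nonneg (elim0 q.2))
        linarith
      exact (le_inv_mul_iff₀ h1).2 (by nlinarith [norm_nonneg (elim0 q.2)])
    induction z using OnePoint.rec with
    | infty =>
      have h1 : Tendsto (fun q : I × OnePoint E => q.2) (𝓝[radSet E] (t, ∞)) (𝓝[≠] ∞) :=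
        continuous_snd.continuousWithinAt.tendsto_nhdsWithin fun q hq => hq.1
      have h2 := tendsto_norm_elim0_nhdsWithin_infty.comp h1
      exact tendsto_atTop_mono' _ (eventually_mem_nhdsWithin.mono hle) h2
    | coe v =>
      have htv : 1 ≤ (t : ℝ) * ‖v‖ := by
        by_contra h
        exact hq ⟨OnePoint.coe_ne_infty v, by simpa using not_le.1 h⟩
      rcases htv.lt_or_eq with hlt | heq
      · -- `t ‖v‖ > 1`: not in the closure of `radSet`
        refine tendsto_atTop_of_not_mem_closure (fun hmem => ?_) _
        have hopen : IsOpen {q : I × OnePoint E | q.2 ≠ ∞ ∧ 1 < (q.1 : ℝ) * ‖elim0 q.2‖} := by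
          have hc : ContinuousOn (fun q : I × OnePoint E => (q.1 : ℝ) * ‖elim0 q.2‖)
              {q | q.2 ≠ ∞} :=
            ht.continuousOn.mul (continuousOn_elim0.comp continuous_snd.continuousOn
              fun q hq => hq).norm
          exact hc.isOpen_inter_preimage (isOpen_ne_infty.preimage continuous_snd)
            (isOpen_Ioi : IsOpen (Ioi (1 : ℝ)))
        have hmem' : ((t, (v : OnePoint E)) : I × OnePoint E) ∈
            {q : I × OnePoint E | q.2 ≠ ∞ ∧ 1 < (q.1 : ℝ) * ‖elim0 q.2‖} :=
          ⟨OnePoint.coe_ne_infty v, by simpa using hlt⟩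
        obtain ⟨q, hq1, hq2⟩ := mem_closure_iff.1 hmem _ hopen hmem'
        exact absurd (hq1.2.trans hq2.2) (lt_irrefl _)
      · -- `t ‖v‖ = 1`: the finite part blows up
        have hv : 0 < ‖v‖ := by
          rcases (norm_nonneg v).lt_or_eq with h | h
          · exact h
          · rw [← h, mul_zero] at heq; exact absurd heq (by norm_num)
        have h1 : Tendsto (fun q : I × OnePoint E => (1 : ℝ) - q.1 * ‖elim0 q.2‖)
            (𝓝[radSet E] (t, ↑v)) (𝓝[>] 0) := by
          rw [tendsto_nhdsWithin_iff]
          refine ⟨?_, eventually_mem_nhdsWithin.mono fun q hq => sub_pos.2 hq.2⟩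
          have hca : ContinuousAt (fun q : I × OnePoint E => elim0 q.2) (t, ↑v) :=
            (continuousAt_elim0 v).comp_of_eq continuous_snd.continuousAt rfl
          have hc : ContinuousAt (fun q : I × OnePoint E => (1 : ℝ) - q.1 * ‖elim0 q.2‖) (t, ↑v) :=
            continuousAt_const.sub (ht.continuousAt.mul hca.norm)
          have := hc.tendsto.mono_left (nhdsWithin_le_nhds (s := radSet E))
          simpa [← heq] using this
        have h2 := tendsto_inv_nhdsGT_zero.comp h1
        have h3 : Tendsto (fun q : I × OnePoint E => ‖elim0 q.2‖) (𝓝[radSet E] (t, ↑v)) (𝓝 ‖v‖) := by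
          have hca : ContinuousAt (fun q : I × OnePoint E => elim0 q.2) (t, ↑v) :=
            (continuousAt_elim0 v).comp_of_eq continuous_snd.continuousAt rfl
          simpa using (hca.tendsto.mono_left nhdsWithin_le_nhds).norm
        have h4 := h2.atTop_mul_pos hv h3
        exact h4.congr' (eventually_mem_nhdsWithin.mono fun q hq => (hnorm q hq).symm)

/-! #### The homotopy equivalence -/

/-- Package a continuous map `[0,1] × X → Y` with prescribed ends as a `Homotopic` statement.
[folklore] -/
theorem homotopic_of_map {X Y : Type*} [TopologicalSpace X] [TopologicalSpace Y] (f g : C(X, Y))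
    (H : I × X → Y) (hH : Continuous H) (h0 : ∀ x, H (0, x) = f x) (h1 : ∀ x, H (1, x) = g x) :
    f.Homotopic g :=
  ⟨{ toFun := H, continuous_toFun := hH, map_zero_left := h0, map_one_left := h1 }⟩

/-- **`M ≃ₕ OnePoint E`**: the pinch map and the cone map are inverse homotopy equivalences.
[folklore] -/
def homotopyEquiv [ProperSpace E] [T2Space M] (hφ : IsOpenEmbedding φ) : M ≃ₕ OnePoint E where
  toFun := ⟨pinch hφ, continuous_pinch hφ⟩
  invFun := ⟨cone hφ, continuous_cone hφ⟩
  left_inv :=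
    (homotopic_of_map (ContinuousMap.id M)
      ((⟨cone hφ, continuous_cone hφ⟩ : C(OnePoint E, M)).comp ⟨pinch hφ, continuous_pinch hφ⟩)
      (homG hφ) (continuous_homG hφ) (homG_zero hφ) (homG_one hφ)).symm
  right_inv := by
    have hk : Continuous (kMap hφ) := by
      have := (continuous_homK (E := E)).comp (Continuous.prodMk_right (1 : I))
      exact this.congr fun z => homK_one hφ z
    let k : C(OnePoint E, OnePoint E) := ⟨kMap hφ, hk⟩
    have h1 : ((⟨pinch hφ, continuous_pinch hφ⟩ : C(M, OnePoint E)).comp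
        ⟨cone hφ, continuous_cone hφ⟩).Homotopic k :=
      homotopic_of_map _ _ (homPsi hφ) (continuous_homPsi hφ) (homPsi_zero hφ) (homPsi_one hφ)
    have h2 : (ContinuousMap.id (OnePoint E)).Homotopic k :=
      homotopic_of_map _ _ (homK E) continuous_homK homK_zero (homK_one hφ)
    exact h1.trans h2.symm

end Right

end Pinch

/-! ### §3 Statements -/

section Statements

variable {E : Type*} [NormedAddCommGroup E] [NormedSpace ℝ E] [ProperSpace E]
  {M : Type*} [TopologicalSpace M] [T2Space M]

/-- **A Hausdorff space which is contractible after removing a point with a Euclidean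
neighbourhood is homotopy equivalent to the one-point compactification of the model space.**
For an open embedding `φ : E → M` of a proper real normed space with `M ∖ {φ 0}` contractible,
`M ≃ₕ OnePoint E` (Hatcher, *Algebraic Topology*, Ch. 0: `M` is the homotopy pushout
`pt ← Sⁿ⁻¹ → pt`, a suspension of the chart sphere). [cite: HatcherAT2002, Ch. 0, Example 0.10 and Prop. 0.17] -/
theorem nonempty_homotopyEquiv_onePoint_of_contractibleSpace_compl {φ : E → M}
    (hφ : IsOpenEmbedding φ) (hc : ContractibleSpace ↥(({φ 0}ᶜ : Set M))) :
    Nonempty (M ≃ₕ OnePoint E) :=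
  ⟨@Pinch.homotopyEquiv E _ M _ φ _ hc _ _ hφ⟩

/-- Local notation: `𝔼 n` is the model Euclidean space `EuclideanSpace ℝ (Fin n)`. -/
local notation "𝔼 " n:arg => EuclideanSpace ℝ (Fin n)

/-- Local notation: `𝕊 n` is the unit sphere in `EuclideanSpace ℝ (Fin (n + 1))`. -/
local notation "𝕊 " n:arg => (Metric.sphere (0 : EuclideanSpace ℝ (Fin (n + 1))) 1)

/-- `OnePoint ℝⁿ ≃ₜ Sⁿ` (Mathlib's `onePointEquivSphereOfFinrankEq`). [folklore] -/
def onePointEuclideanHomeomorphSphere (n : ℕ) : OnePoint (𝔼 n) ≃ₜ 𝕊 n :=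
  onePointEquivSphereOfFinrankEq (by simp)

/-- **A Hausdorff space which is contractible after removing a point with a Euclidean
neighbourhood `ℝⁿ` is a homotopy `n`-sphere**: for an open embedding `φ : ℝⁿ → M` with
`M ∖ {φ 0}` contractible, `M ≃ₕ Sⁿ`. [cite: HatcherAT2002, Ch. 0, Example 0.10 and Prop. 0.17] -/
theorem nonempty_homotopyEquiv_sphere_of_contractibleSpace_compl {n : ℕ} {φ : 𝔼 n → M}
    (hφ : IsOpenEmbedding φ) (hc : ContractibleSpace ↥(({φ 0}ᶜ : Set M))) :
    Nonempty (M ≃ₕ 𝕊 n) := by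
  obtain ⟨e⟩ := nonempty_homotopyEquiv_onePoint_of_contractibleSpace_compl hφ hc
  exact ⟨e.trans (onePointEuclideanHomeomorphSphere n).toHomotopyEquiv⟩

/-- Variant with the puncture hypothesis on the subtype `{x // x ≠ φ 0}`. [folklore] -/
theorem nonempty_homotopyEquiv_sphere_of_contractibleSpace_ne {n : ℕ} {φ : 𝔼 n → M}
    (hφ : IsOpenEmbedding φ) (hc : ContractibleSpace {x : M // x ≠ φ 0}) :
    Nonempty (M ≃ₕ 𝕊 n) :=
  nonempty_homotopyEquiv_sphere_of_contractibleSpace_compl hφ hc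

end Statements

end Literature.AlgebraicTopology.Homotopy

end
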